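import Literature.Analysis.FluidPDE.PerpGradientTestField
import HarnessLib

/-!
# The slice identity behind the weak vorticity formulation on `T²`

Analysis/FluidPDE proof-support file (theorem-only, everything proved). For one time slice
`w = v(t) ∈ L²(T²; ℝ²)` with an `L²` weak curl `ωt` (`∫(∂₀χ·w₁ - ∂₁χ·w₀) = -∫ χ ωt` for smooth
`χ`), a scalar space–time test function `φ` and a smooth steady force `g`, testing the
Navier–Stokes integrand of the Leray–Hopf weak formulation against the perpendicular gradient
`∇^⊥φ(t)` yields MINUS the integrand of the weak vorticity equation against `φ(t)`:
time-derivative and viscous terms by the weak-curl identity (`χ = ∂ₜφ(t), Δφ(t)`, using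
`PerpGrad.timeDeriv_eq`, `PerpGrad.laplacian_eq`), the force term by integration by parts
(`PerpGrad.integral_inner_smooth`), and the nonlinear term through the hypothesis
`∫⟪w,(w·∇)∇^⊥φ⟫ = -∫ ωt ⟪w, ∇φ⟫` (true for weakly divergence-free `w ∈ L²`, proved in the
Summits file `TwoAndHalfDTwohalfdNegWeakVorticityNonlinear`). This is the slice-wise content of the
two-dimensional vorticity formulation (Majda–Bertozzi 2002, §2.1 and Prop. 2.7; Kuksin–Shirikyan
2012, §2.1).

## References

* A. J. Majda, A. L. Bertozzi, *Vorticity and Incompressible Flow*, CUP 2002, §2.1, Prop. 2.7.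
* S. Kuksin, A. Shirikyan, *Mathematics of Two-Dimensional Turbulence*, CUP 2012, §2.1.
-/

noncomputable section

open MeasureTheory Filter Topology Set Function
open scoped ENNReal NNReal

namespace Literature.Analysis.FluidPDE.Torus

open Literature.Analysis.FunctionSpaces

/-- **The slice identity.** For a slice `w ∈ L²(T²; ℝ²)` with `L²` weak curl `ωt`, a scalar
space–time test `φ`, a smooth `g`, and the nonlinear identity `∫⟪w,(w·∇)∇^⊥φ(t)⟫ = -∫ ωt ⟪w,∇φ(t)⟫`
as hypothesis: the Navier–Stokes integrand tested against `∇^⊥φ(t)` integrates to minus the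
vorticity-transport integrand tested against `φ(t)` (weak curl for the linear terms, integration
by parts for the force; Majda–Bertozzi 2002, §2.1). [cite: MajdaBertozzi2002, §2.1 Prop. 2.7] -/
theorem vorticity_slice_identity {ν T : ℝ} {g w : UnitAddTorus (Fin 2) → EuclideanSpace ℝ (Fin 2)}
    {ωt : UnitAddTorus (Fin 2) → ℝ} {φ : ℝ → UnitAddTorus (Fin 2) → ℝ} (hg : Torus.IsSmooth g)
    (hφ : Torus.IsSpaceTimeTest T φ) (hw : MemLp w 2 volume) (hω : MemLp ωt 2 volume)
    (hcurl : ∀ χ : UnitAddTorus (Fin 2) → ℝ, Torus.IsSmooth χ →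
      ∫ x, (Torus.partialDeriv 0 χ x * w x 1 - Torus.partialDeriv 1 χ x * w x 0) = -∫ x, χ x * ωt x)
    (t : ℝ)
    (hnl : ∫ x, inner ℝ (w x) (Torus.convect w (fun x =>
        (-Torus.partialDeriv 1 (φ t) x) • EuclideanSpace.single (0 : Fin 2) (1 : ℝ) +
          Torus.partialDeriv 0 (φ t) x • EuclideanSpace.single (1 : Fin 2) (1 : ℝ)) x) =
      -∫ x, ωt x * inner ℝ (w x) (Torus.gradient (φ t) x)) :
    ∫ x, (inner ℝ (w x) (Torus.timeDeriv (fun t x =>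
          (-Torus.partialDeriv 1 (φ t) x) • EuclideanSpace.single (0 : Fin 2) (1 : ℝ) +
            Torus.partialDeriv 0 (φ t) x • EuclideanSpace.single (1 : Fin 2) (1 : ℝ)) t x) +
        inner ℝ (w x) (Torus.convect w (fun x =>
          (-Torus.partialDeriv 1 (φ t) x) • EuclideanSpace.single (0 : Fin 2) (1 : ℝ) +
            Torus.partialDeriv 0 (φ t) x • EuclideanSpace.single (1 : Fin 2) (1 : ℝ)) x) +
        ν * inner ℝ (w x) (Torus.laplacian (fun x =>
          (-Torus.partialDeriv 1 (φ t) x) • EuclideanSpace.single (0 : Fin 2) (1 : ℝ) +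
            Torus.partialDeriv 0 (φ t) x • EuclideanSpace.single (1 : Fin 2) (1 : ℝ)) x) +
        inner ℝ (g x) ((-Torus.partialDeriv 1 (φ t) x) • EuclideanSpace.single (0 : Fin 2) (1 : ℝ) +
            Torus.partialDeriv 0 (φ t) x • EuclideanSpace.single (1 : Fin 2) (1 : ℝ))) =
      -((∫ x, ωt x * (Torus.timeDeriv φ t x + inner ℝ (w x) (Torus.gradient (φ t) x) +
          ν * Torus.laplacian (φ t) x)) +
        ∫ x, (Torus.partialDeriv 0 g x 1 - Torus.partialDeriv 1 g x 0) * φ t x) := by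
  have hφt : Torus.IsSmooth (φ t) := hφ.isSmooth_slice t
  have hχ₁ : Torus.IsSmooth (Torus.timeDeriv φ t) := hφ.timeDeriv.isSmooth_slice t
  have hχ₂ : Torus.IsSmooth (Torus.laplacian (φ t)) := hφt.laplacian
  have hωi : Integrable ωt volume := hω.integrable one_le_two
  -- T1: the time-derivative term
  have hT1 : ∫ x, inner ℝ (w x) (Torus.timeDeriv (fun t x =>
      (-Torus.partialDeriv 1 (φ t) x) • EuclideanSpace.single (0 : Fin 2) (1 : ℝ) +
        Torus.partialDeriv 0 (φ t) x • EuclideanSpace.single (1 : Fin 2) (1 : ℝ)) t x) =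
      -∫ x, Torus.timeDeriv φ t x * ωt x := by
    rw [← hcurl _ hχ₁]
    refine integral_congr_ae (ae_of_all _ fun x => ?_)
    beta_reduce
    rw [PerpGrad.timeDeriv_eq hφ.1 t x, PerpGrad.inner_smul_e_add]
    ring
  -- T2: the nonlinear term is the hypothesis `hnl`
  -- T3: the viscous term
  have hT3 : ∫ x, ν * inner ℝ (w x) (Torus.laplacian (fun x =>
      (-Torus.partialDeriv 1 (φ t) x) • EuclideanSpace.single (0 : Fin 2) (1 : ℝ) +
        Torus.partialDeriv 0 (φ t) x • EuclideanSpace.single (1 : Fin 2) (1 : ℝ)) x) =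
      -(ν * ∫ x, Torus.laplacian (φ t) x * ωt x) := by
    have h3 : ∫ x, inner ℝ (w x) (Torus.laplacian (fun x =>
        (-Torus.partialDeriv 1 (φ t) x) • EuclideanSpace.single (0 : Fin 2) (1 : ℝ) +
          Torus.partialDeriv 0 (φ t) x • EuclideanSpace.single (1 : Fin 2) (1 : ℝ)) x) =
        -∫ x, Torus.laplacian (φ t) x * ωt x := by
      rw [← hcurl _ hχ₂]
      refine integral_congr_ae (ae_of_all _ fun x => ?_)
      beta_reduce
      rw [PerpGrad.laplacian_eq hφt x, PerpGrad.inner_smul_e_add]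
      ring
    rw [integral_const_mul, h3, mul_neg]
  -- T4: the force term
  have hT4 := PerpGrad.integral_inner_smooth hg hφt
  -- integrability of the four integrands
  have hI1 : Integrable (fun x => inner ℝ (w x) (Torus.timeDeriv (fun t x =>
      (-Torus.partialDeriv 1 (φ t) x) • EuclideanSpace.single (0 : Fin 2) (1 : ℝ) +
        Torus.partialDeriv 0 (φ t) x • EuclideanSpace.single (1 : Fin 2) (1 : ℝ)) t x)) volume := by
    have e : (fun x => inner ℝ (w x) (Torus.timeDeriv (fun t x =>
        (-Torus.partialDeriv 1 (φ t) x) • EuclideanSpace.single (0 : Fin 2) (1 : ℝ) +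
          Torus.partialDeriv 0 (φ t) x • EuclideanSpace.single (1 : Fin 2) (1 : ℝ)) t x)) =
        fun x => (-Torus.partialDeriv 1 (Torus.timeDeriv φ t) x) * w x 0 +
          Torus.partialDeriv 0 (Torus.timeDeriv φ t) x * w x 1 := by
      funext x; rw [PerpGrad.timeDeriv_eq hφ.1 t x, PerpGrad.inner_smul_e_add]; ring
    rw [e]
    exact (PerpGrad.integrable_continuous_mul (hχ₁.partialDeriv 1).continuous.neg (PerpGrad.integrable_apply_of_memLp hw 0)).add
      (PerpGrad.integrable_continuous_mul (hχ₁.partialDeriv 0).continuous (PerpGrad.integrable_apply_of_memLp hw 1))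
  have hI2 : Integrable (fun x => inner ℝ (w x) (Torus.convect w (fun x =>
      (-Torus.partialDeriv 1 (φ t) x) • EuclideanSpace.single (0 : Fin 2) (1 : ℝ) +
        Torus.partialDeriv 0 (φ t) x • EuclideanSpace.single (1 : Fin 2) (1 : ℝ)) x)) volume :=
    integrable_inner_convect' hw hw (PerpGrad.isSmooth hφt)
  have hI3 : Integrable (fun x => ν * inner ℝ (w x) (Torus.laplacian (fun x =>
      (-Torus.partialDeriv 1 (φ t) x) • EuclideanSpace.single (0 : Fin 2) (1 : ℝ) +
        Torus.partialDeriv 0 (φ t) x • EuclideanSpace.single (1 : Fin 2) (1 : ℝ)) x)) volume := by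
    have e : (fun x => ν * inner ℝ (w x) (Torus.laplacian (fun x =>
        (-Torus.partialDeriv 1 (φ t) x) • EuclideanSpace.single (0 : Fin 2) (1 : ℝ) +
          Torus.partialDeriv 0 (φ t) x • EuclideanSpace.single (1 : Fin 2) (1 : ℝ)) x)) =
        fun x => ν * ((-Torus.partialDeriv 1 (Torus.laplacian (φ t)) x) * w x 0 +
          Torus.partialDeriv 0 (Torus.laplacian (φ t)) x * w x 1) := by
      funext x; rw [PerpGrad.laplacian_eq hφt x, PerpGrad.inner_smul_e_add]; ring
    rw [e]
    exact ((PerpGrad.integrable_continuous_mul (hχ₂.partialDeriv 1).continuous.neg (PerpGrad.integrable_apply_of_memLp hw 0)).add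
      (PerpGrad.integrable_continuous_mul (hχ₂.partialDeriv 0).continuous (PerpGrad.integrable_apply_of_memLp hw 1))).const_mul ν
  have hI4 : Integrable (fun x => inner ℝ (g x) ((-Torus.partialDeriv 1 (φ t) x) •
      EuclideanSpace.single (0 : Fin 2) (1 : ℝ) +
        Torus.partialDeriv 0 (φ t) x • EuclideanSpace.single (1 : Fin 2) (1 : ℝ))) volume :=
    (hg.inner (PerpGrad.isSmooth hφt)).integrable
  -- integrability of the three pieces of the scalar integrand
  have hJ1 : Integrable (fun x => ωt x * Torus.timeDeriv φ t x) volume := by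
    simpa only [mul_comm] using PerpGrad.integrable_continuous_mul hχ₁.continuous hωi
  have hJ2 : Integrable (fun x => ωt x * inner ℝ (w x) (Torus.gradient (φ t) x)) volume :=
    PerpGrad.integrable_mul_inner hω hw hφt.gradient.continuous
  have hJ3 : Integrable (fun x => ωt x * (ν * Torus.laplacian (φ t) x)) volume := by
    have hc : Continuous fun x => ν * Torus.laplacian (φ t) x := continuous_const.mul hχ₂.continuous
    have h := PerpGrad.integrable_continuous_mul hc hωi
    refine h.congr (ae_of_all _ fun x => ?_)
    beta_reduce
    ring
  have hJ12 : Integrable (fun x => ωt x * Torus.timeDeriv φ t x +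
      ωt x * inner ℝ (w x) (Torus.gradient (φ t) x)) volume := hJ1.add hJ2
  have hI12 : Integrable (fun x => inner ℝ (w x) (Torus.timeDeriv (fun t x =>
      (-Torus.partialDeriv 1 (φ t) x) • EuclideanSpace.single (0 : Fin 2) (1 : ℝ) +
        Torus.partialDeriv 0 (φ t) x • EuclideanSpace.single (1 : Fin 2) (1 : ℝ)) t x) +
      inner ℝ (w x) (Torus.convect w (fun x =>
        (-Torus.partialDeriv 1 (φ t) x) • EuclideanSpace.single (0 : Fin 2) (1 : ℝ) +
          Torus.partialDeriv 0 (φ t) x • EuclideanSpace.single (1 : Fin 2) (1 : ℝ)) x)) volume := hI1.add hI2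
  have hI123 : Integrable (fun x => inner ℝ (w x) (Torus.timeDeriv (fun t x =>
      (-Torus.partialDeriv 1 (φ t) x) • EuclideanSpace.single (0 : Fin 2) (1 : ℝ) +
        Torus.partialDeriv 0 (φ t) x • EuclideanSpace.single (1 : Fin 2) (1 : ℝ)) t x) +
      inner ℝ (w x) (Torus.convect w (fun x =>
        (-Torus.partialDeriv 1 (φ t) x) • EuclideanSpace.single (0 : Fin 2) (1 : ℝ) +
          Torus.partialDeriv 0 (φ t) x • EuclideanSpace.single (1 : Fin 2) (1 : ℝ)) x) +
      ν * inner ℝ (w x) (Torus.laplacian (fun x =>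
        (-Torus.partialDeriv 1 (φ t) x) • EuclideanSpace.single (0 : Fin 2) (1 : ℝ) +
          Torus.partialDeriv 0 (φ t) x • EuclideanSpace.single (1 : Fin 2) (1 : ℝ)) x)) volume := hI12.add hI3
  -- assemble
  rw [integral_add hI123 hI4, integral_add hI12 hI3, integral_add hI1 hI2, hT1, hnl, hT3, hT4]
  have eR : ∫ x, ωt x * (Torus.timeDeriv φ t x + inner ℝ (w x) (Torus.gradient (φ t) x) +
      ν * Torus.laplacian (φ t) x) =
      (∫ x, ωt x * Torus.timeDeriv φ t x) + (∫ x, ωt x * inner ℝ (w x) (Torus.gradient (φ t) x)) +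
        ∫ x, ωt x * (ν * Torus.laplacian (φ t) x) := by
    rw [← integral_add hJ1 hJ2, ← integral_add hJ12 hJ3]
    refine integral_congr_ae (ae_of_all _ fun x => ?_)
    beta_reduce
    ring
  have e1 : ∫ x, Torus.timeDeriv φ t x * ωt x = ∫ x, ωt x * Torus.timeDeriv φ t x :=
    integral_congr_ae (ae_of_all _ fun x => mul_comm _ _)
  have e3 : ∫ x, ωt x * (ν * Torus.laplacian (φ t) x) = ν * ∫ x, Torus.laplacian (φ t) x * ωt x := by
    rw [← integral_const_mul]
    exact integral_congr_ae (ae_of_all _ fun x => by ring)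
  have e4 : ∫ x, (Torus.partialDeriv 0 g x 1 - Torus.partialDeriv 1 g x 0) * φ t x =
      ∫ x, φ t x * (Torus.partialDeriv 0 g x 1 - Torus.partialDeriv 1 g x 0) :=
    integral_congr_ae (ae_of_all _ fun x => mul_comm _ _)
  rw [eR, e1, e3, e4]
  ring


end Literature.Analysis.FluidPDE.Torus

end
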